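import Summits.ValiantsHypothesis.ValiantsHypothesis.Theorems.NewtonUnitEquationsTwoProductsConfinedTameLawSliceFibre
import HarnessLib

/-!
# R10 (`positive-circuit-chart`) — ENGINE F5: per visible point, a ZERO-AVOIDING STRICT PENCIL-MINIMISER of a slice function
For chart data `Ch` confined to `Lι` (with `Λ ⊆ ker σ`-positivity: no nonzero nonnegative saturated lattice vector) and a valid cell
weight `ξ` whose letter weights are `Λ`-orthogonal, every strict `ξ`-top `l` of the tail support yields: an upstairs point `x₀` over `D·l`,
its pattern class `Φ = cls x₀` with base mass `B₀`, and the free exponent `μ = fr(x₀)`, such that the indicator-weighted slice function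
`FslI Lι Φ B₀ cU cV` is nonzero at `μ` and `μ` is a STRICT minimiser of the letter-weight functional `Σ_k rW ξ k ν k` among all `ν ≠ μ`
with `FslI … ν ≠ 0` (Lemma A `toric_minLog` upstairs + the fibre-sum identity + the competitor dichotomy on the truncation order).
R275 P3 scope: tool for the proper positive sub-case rung `ConfinedTameLaw`; nothing here closes 5906; VP ≠ VNP is NOT proved.
-/

noncomputable section
set_option linter.dupNamespace false
set_option linter.unusedSectionVars false

namespace Summit.ValiantsHypothesis.ValiantsHypothesis.Theorems.NewtonUnitEquations.TwoProducts.PermutationType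
namespace R10
open scoped BigOperators
open MvPolynomial
open Summit.ValiantsHypothesis.ValiantsHypothesis.Theorems.NewtonUnitEquations.TwoProducts.FormalLogLinearisation
open Summit.ValiantsHypothesis.ValiantsHypothesis.Theorems.NewtonUnitEquations.TwoProducts.PlanarCell

section Indicator
variable {σ : Type*} [Fintype σ] [DecidableEq σ] {m : ℕ}

/-- Indicator of free exponents (vanishing on the relation letters `Lι`). [folklore] -/
def ind (Lι : Finset σ) (ν : σ → ℕ) : ℂ := if ∀ k ∈ Lι, ν k = 0 then 1 else 0

/-- The indicator is multiplicative under addition of exponents. [folklore] -/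
theorem ind_add (Lι : Finset σ) (β w : σ → ℕ) : ind Lι (β + w) = ind Lι β * ind Lι w := by
  unfold ind
  by_cases hβ : ∀ k ∈ Lι, β k = 0
  · by_cases hw : ∀ k ∈ Lι, w k = 0
    · rw [if_pos hβ, if_pos hw, if_pos (fun k hk => by simp [Pi.add_apply, hβ k hk, hw k hk])]; simp
    · rw [if_pos hβ, if_neg hw, if_neg (fun h => hw fun k hk => by have := h k hk; simp [Pi.add_apply, hβ k hk] at this; exact this)]
      simp
  · rw [if_neg hβ, if_neg (fun h => hβ fun k hk => by have := h k hk; simp [Pi.add_apply] at this; exact this.1), zero_mul]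

/-- The INDICATOR-WEIGHTED slice function (free exponents only). [folklore] -/
def FslI (Lι : Finset σ) (Φ : Finset (σ →₀ ℕ)) (B₀ : ℕ) (c d : Fin m → σ → ℂ) (ν : σ → ℕ) : ℂ :=
  ind Lι ν * Fsl Φ B₀ c d ν

/-- Its finite shift rank (same index type `Fin m × Bool × Fin (Δ+1)`). [folklore] -/
theorem FslI_shift (Lι : Finset σ) (Φ : Finset (σ →₀ ℕ)) (B₀ Δ : ℕ) (c d : Fin m → σ → ℂ) (hΦ : ∀ b ∈ Φ, deg b - B₀ ≤ Δ)
    (β w : σ → ℕ) :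
    FslI Lι Φ B₀ c d (β + w) = ∑ t : SIdx m Δ, (ind Lι β * col Δ c d β t) * (ind Lι w * ch Φ B₀ Δ c d t w) := by
  unfold FslI
  rw [ind_add, Fsl_shift Φ B₀ Δ c d hΦ β w, Finset.mul_sum]
  exact Finset.sum_congr rfl fun t _ => by ring

/-- Nonvanishing of `FslI` forces the exponent to be free. [folklore] -/
theorem free_of_FslI_ne_zero {Lι : Finset σ} {Φ : Finset (σ →₀ ℕ)} {B₀ : ℕ} {c d : Fin m → σ → ℂ} {ν : σ → ℕ}
    (h : FslI Lι Φ B₀ c d ν ≠ 0) : ∀ k ∈ Lι, ν k = 0 := by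
  by_contra hk
  apply h
  unfold FslI ind
  rw [if_neg hk, zero_mul]

/-- Degree is dominated by the `θ`-weight when `θ ≥ 1`. [folklore] -/
theorem deg_le_lwt {τ : Type*} [Fintype τ] (θ : τ → ℝ) (hθ : ∀ a, 1 ≤ θ a) (x : τ →₀ ℕ) : (deg x : ℝ) ≤ lwt θ x := by
  rw [deg_eq_sum, Nat.cast_sum]
  unfold lwt
  exact Finset.sum_le_sum fun a _ => by
    have := hθ a; have h0 : (0 : ℝ) ≤ (x a : ℕ) := Nat.cast_nonneg _; nlinarith

end Indicator

section SliceMin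
variable {m : ℕ}
variable {u v : Fin m → MvPolynomial (Fin 2) ℂ}
variable (Ch : ChartData u v) (Lι : Finset (Fin (sE u v)))

/-- POSITIVITY of the lattice of the chart data `Ch'`: no nonzero nonnegative letter vector is saturated-equivalent to `0`
(holds for every `Λ ⊆ ker σ` since letters are nonzero planar vectors). -/
def ChartData.Positive (Ch' : ChartData u v) : Prop :=
  ∀ b : Fin (sE u v) →₀ ℕ, (∃ k : ℕ, 0 < k ∧ (fun i => (k : ℤ) * tableZ u v b i) ∈ Ch'.Λ) → b = 0

/-- A free finsupp from a free function. [folklore] -/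
def freeOf (ν : Fin (sE u v) → ℕ) : Fin (sE u v) →₀ ℕ := Finsupp.equivFunOnFinite.symm ν

/-- Coercion of `freeOf`. [folklore] -/
theorem coe_freeOf (ν : Fin (sE u v) → ℕ) : ⇑(freeOf ν) = ν := by unfold freeOf; simp

/-- The free part of `f + b` is `f` when `f` is free and `b` is a pattern. [folklore] -/
theorem frP_add_of_free {f b : Fin (sE u v) →₀ ℕ} (hf : ∀ k ∈ Lι, f k = 0) (hb : ∀ k, k ∉ Lι → b k = 0) :
    frP Lι (f + b) = f := by
  ext k
  rw [frP_apply, Finsupp.add_apply]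
  by_cases hk : k ∈ Lι
  · simp [hk, hf k hk]
  · simp [hk, hb k hk]

/-- The pattern part of `f + b` is `b` under the same hypotheses. [folklore] -/
theorem lpP_add_of_free {f b : Fin (sE u v) →₀ ℕ} (hf : ∀ k ∈ Lι, f k = 0) (hb : ∀ k, k ∉ Lι → b k = 0) :
    lpP Lι (f + b) = b := by
  ext k
  rw [lpP_apply, Finsupp.add_apply]
  by_cases hk : k ∈ Lι
  · simp [hk, hf k hk]
  · simp [hk, hb k hk]

/-- The free part is free; the pattern part is a pattern. [folklore] -/
theorem frP_free (κ : Fin (sE u v) →₀ ℕ) : ∀ k ∈ Lι, frP Lι κ k = 0 := fun k hk => by rw [frP_apply]; simp [hk]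

/-- The pattern part is a pattern. [folklore] -/
theorem lpP_pattern (κ : Fin (sE u v) →₀ ℕ) : ∀ k, k ∉ Lι → lpP Lι κ k = 0 := fun k hk => by rw [lpP_apply]; simp [hk]

/-- Class members are patterns (supported on `Lι`). [folklore] -/
theorem ChartData.pattern_of_mem_cls {x : Fin Ch.N →₀ ℕ} {b : Fin (sE u v) →₀ ℕ} (hb : b ∈ Ch.cls Lι x) :
    ∀ k, k ∉ Lι → b k = 0 := by
  classical
  unfold ChartData.cls at hb
  obtain ⟨κ, -, rfl⟩ := Finset.mem_image.mp hb
  intro k hk; rw [lpP_apply]; simp [hk]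

/-- **Class invariance along the free direction**: moving the free part does not change the pattern class. [folklore] -/
theorem ChartData.cls_free (hc : Ch.Confined Lι) {x : Fin Ch.N →₀ ℕ} {κ₀ : Fin (sE u v) →₀ ℕ} (h₀ : κ₀ ∈ Ch.Fib x)
    {ν : Fin (sE u v) → ℕ} (hν : ∀ k ∈ Lι, ν k = 0) :
    Ch.cls Lι (piT Ch.M (freeOf ν + lpP Lι κ₀)) = Ch.cls Lι x := by
  classical
  have hνf : ∀ k ∈ Lι, freeOf ν k = 0 := fun k hk => by rw [coe_freeOf]; exact hν k hk
  have hmem₀ : freeOf ν + lpP Lι κ₀ ∈ Ch.Fib (piT Ch.M (freeOf ν + lpP Lι κ₀)) := (Ch.mem_Fib _ _).2 rfl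
  have h0' : frP Lι κ₀ + lpP Lι κ₀ ∈ Ch.Fib x := by rw [frP_add_lpP]; exact h₀
  -- transport of saturated differences between the two base points
  have key : ∀ b : Fin (sE u v) →₀ ℕ,
      (frP Lι κ₀ + b ∈ Ch.Fib x ↔ freeOf ν + b ∈ Ch.Fib (piT Ch.M (freeOf ν + lpP Lι κ₀))) := by
    intro b
    have hdiff : (tableZ u v (freeOf ν + b) - tableZ u v (freeOf ν + lpP Lι κ₀)) =
        (tableZ u v (frP Lι κ₀ + b) - tableZ u v (frP Lι κ₀ + lpP Lι κ₀)) := by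
      funext i; simp only [Pi.sub_apply, tableZ, Finsupp.add_apply]; push_cast; ring
    constructor
    · intro h
      obtain ⟨k, hk, hkm⟩ := Ch.sat_of_mem_Fib h h0'
      exact Ch.mem_Fib_of_sat hmem₀ ⟨k, hk, by rw [hdiff]; exact hkm⟩
    · intro h
      obtain ⟨k, hk, hkm⟩ := Ch.sat_of_mem_Fib h hmem₀
      exact Ch.mem_Fib_of_sat h0' ⟨k, hk, by rw [← hdiff]; exact hkm⟩
  ext b
  unfold ChartData.cls
  simp only [Finset.mem_image]
  constructor
  · rintro ⟨κ, hκ, rfl⟩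
    have hfr : frP Lι κ = freeOf ν := by
      rw [Ch.frP_eq_of_mem_Fib Lι hc hmem₀ hκ, frP_add_of_free Lι hνf (lpP_pattern Lι κ₀)]
    have h1 : freeOf ν + lpP Lι κ ∈ Ch.Fib (piT Ch.M (freeOf ν + lpP Lι κ₀)) := by
      have e : freeOf ν + lpP Lι κ = κ := by rw [← hfr, frP_add_lpP]
      rw [e]; exact hκ
    exact ⟨frP Lι κ₀ + lpP Lι κ, (key _).2 h1, lpP_add_of_free Lι (frP_free Lι κ₀) (lpP_pattern Lι κ)⟩
  · rintro ⟨κ', hκ', rfl⟩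
    have h1 : frP Lι κ₀ + lpP Lι κ' ∈ Ch.Fib x := by
      have e : frP Lι κ₀ + lpP Lι κ' = κ' := by rw [← Ch.frP_eq_of_mem_Fib Lι hc h₀ hκ', frP_add_lpP]
      rw [e]; exact hκ'
    exact ⟨freeOf ν + lpP Lι κ', (key _).1 h1, lpP_add_of_free Lι hνf (lpP_pattern Lι κ')⟩

/-! ### Base mass, free exponent, and the main theorem -/

/-- The base mass of the pattern class of `x` (minimum pattern degree; `0` for an empty class). [folklore] -/
def ChartData.bmin (x : Fin Ch.N →₀ ℕ) : ℕ := sInf ((fun b : Fin (sE u v) →₀ ℕ => deg b) '' ↑(Ch.cls Lι x))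

/-- The base mass is a lower bound of the class degrees. [folklore] -/
theorem ChartData.bmin_le {x : Fin Ch.N →₀ ℕ} {b : Fin (sE u v) →₀ ℕ} (hb : b ∈ Ch.cls Lι x) : Ch.bmin Lι x ≤ deg b :=
  Nat.sInf_le ⟨b, hb, rfl⟩

/-- The base mass is attained (nonempty class). [folklore] -/
theorem ChartData.exists_deg_eq_bmin {x : Fin Ch.N →₀ ℕ} (hne : (Ch.cls Lι x).Nonempty) :
    ∃ b ∈ Ch.cls Lι x, deg b = Ch.bmin Lι x := by
  have hne' : ((fun b : Fin (sE u v) →₀ ℕ => deg b) '' ↑(Ch.cls Lι x)).Nonempty := by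
    obtain ⟨b, hb⟩ := hne; exact ⟨deg b, b, hb, rfl⟩
  obtain ⟨b, hb, hdb⟩ := Nat.sInf_mem hne'
  exact ⟨b, hb, hdb⟩

/-- The pattern part of a fibre element lies in the class. [folklore] -/
theorem ChartData.lpP_mem_cls {x : Fin Ch.N →₀ ℕ} {κ : Fin (sE u v) →₀ ℕ} (hκ : κ ∈ Ch.Fib x) : lpP Lι κ ∈ Ch.cls Lι x := by
  classical
  unfold ChartData.cls; exact Finset.mem_image_of_mem _ hκ

/-- Class members give fibre elements over the common free part. [folklore] -/
theorem ChartData.frP_add_mem_Fib (hc : Ch.Confined Lι) {x : Fin Ch.N →₀ ℕ} {κ₀ b : Fin (sE u v) →₀ ℕ} (h₀ : κ₀ ∈ Ch.Fib x)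
    (hb : b ∈ Ch.cls Lι x) : frP Lι κ₀ + b ∈ Ch.Fib x := by
  classical
  unfold ChartData.cls at hb
  obtain ⟨κ, hκ, rfl⟩ := Finset.mem_image.mp hb
  rw [← Ch.frP_eq_of_mem_Fib Lι hc h₀ hκ, frP_add_lpP]; exact hκ

/-- Under positivity, a class containing `0` is `{0}`. [folklore] -/
theorem ChartData.cls_eq_zero_of_zero_mem (hc : Ch.Confined Lι) (hpos : Ch.Positive) {x : Fin Ch.N →₀ ℕ}
    {κ₀ : Fin (sE u v) →₀ ℕ} (h₀ : κ₀ ∈ Ch.Fib x) (hz : (0 : Fin (sE u v) →₀ ℕ) ∈ Ch.cls Lι x) :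
    ∀ b ∈ Ch.cls Lι x, b = 0 := by
  intro b hb
  have h1 := Ch.frP_add_mem_Fib Lι hc h₀ hb
  have h2 := Ch.frP_add_mem_Fib Lι hc h₀ hz
  obtain ⟨k, hk, hkm⟩ := Ch.sat_of_mem_Fib h1 h2
  refine hpos b ⟨k, hk, ?_⟩
  have : (fun i => (k : ℤ) * (tableZ u v (frP Lι κ₀ + b) - tableZ u v (frP Lι κ₀ + 0)) i) =
      fun i => (k : ℤ) * tableZ u v b i := by
    funext i; simp [tableZ, Finsupp.add_apply]
  rw [← this]; exact hkm

/-- `momF` of the zero exponent. [folklore] -/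
theorem momF_zero' {σ : Type*} [Fintype σ] (a : σ → ℂ) : momF a (0 : σ → ℕ) = 1 := by
  unfold momF; simp

/-- The slice function of the trivial class vanishes at the zero exponent. [folklore] -/
theorem Fsl_trivial (c d : Fin m → Fin (sE u v) → ℂ) (B₀ : ℕ) (Φ : Finset (Fin (sE u v) →₀ ℕ)) (hΦ : ∀ b ∈ Φ, b = 0) :
    Fsl Φ B₀ c d (0 : Fin (sE u v) → ℕ) = 0 := by
  unfold Fsl
  refine Finset.sum_eq_zero fun b hb => ?_
  rw [hΦ b hb]
  have : ∀ a : Fin (sE u v) → ℂ, mom a (0 : Fin (sE u v) →₀ ℕ) = 1 := fun a => by unfold mom; simp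
  simp [momF_zero', this]

/-- The lift has no constant term: `0 ∉ GT.support`. [folklore] -/
theorem ChartData.zero_not_mem_support_GT : (0 : Fin Ch.N →₀ ℕ) ∉ Ch.GT.support := by
  classical
  intro h
  obtain ⟨L, hL, hL0⟩ := Ch.exists_of_mem_support_GT 0 h
  have hLz : L = 0 := by
    ext k
    have := Ch.le_piT_atomOf L k
    rw [hL0] at this
    simpa using this
  rw [hLz, mem_support_iff] at hL
  apply hL
  unfold liftG
  rw [coeff_sub, sub_eq_zero]
  have h1 : ∀ a : Fin m → Fin (sE u v) → ℂ, coeff 0 (∏ j, (1 + lin (a j))) = 1 := by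
    intro a
    rw [← constantCoeff_eq, map_prod]
    refine Finset.prod_eq_one fun j _ => ?_
    rw [map_add, map_one]
    unfold lin
    rw [map_sum]
    simp
  rw [h1, h1]

/-- **MAIN (F5): per visible point, a zero-avoiding strict pencil-minimiser of the indicator-weighted slice function.** [folklore] -/
theorem ChartData.sliceMin_of_visible (hc : Ch.Confined Lι) (hpos : Ch.Positive) (ξ : Fin 2 → ℝ) (hval : ValidWeight u v ξ)
    (horth : ∀ z ∈ Ch.Λ, ∑ i, (z i : ℝ) * rW (u := u) (v := v) ξ i = 0) (l : Expo)
    (htop : IsStrictTop ξ ↑(tailDiff u v).support l) :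
    ∃ x₀ : Fin Ch.N →₀ ℕ, piE Ch.G x₀ = Ch.D • l ∧ ∃ L₀ : Fin (sE u v) →₀ ℕ,
      L₀ ∈ (liftG (cU u v) (cV u v)).support ∧ piT Ch.M L₀ = x₀ ∧
      FslI Lι (Ch.cls Lι x₀) (Ch.bmin Lι x₀) (cU u v) (cV u v) ⇑(frP Lι L₀) ≠ 0 ∧
      ∀ ν : Fin (sE u v) → ℕ, ν ≠ ⇑(frP Lι L₀) → FslI Lι (Ch.cls Lι x₀) (Ch.bmin Lι x₀) (cU u v) (cV u v) ν ≠ 0 →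
        ∑ k, rW (u := u) (v := v) ξ k * ((frP Lι L₀ k : ℕ) : ℝ) < ∑ k, rW (u := u) (v := v) ξ k * (ν k : ℝ) := by
  classical
  obtain ⟨x₀, hx₀, hπ, hmax⟩ := Ch.lifted_of_visible ξ l htop
  obtain ⟨θ, hθ, c, hcpos, hlw⟩ := Ch.exists_theta ξ hval horth
  have hDpos : (0 : ℝ) < Ch.D := by exact_mod_cast Ch.D_pos
  -- θ-weight of a lifted exponent in terms of the planar weight
  have hlwL : ∀ L : Fin (sE u v) →₀ ℕ, lwt θ (piT Ch.M L) = -(c / Ch.D) * wt ξ (piE Ch.G (piT Ch.M L)) := by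
    intro L
    rw [hlw L, Ch.piE_G_piT, wt_nsmul]
    have e : ∑ k, rW (u := u) (v := v) ξ k * ((L k : ℕ) : ℝ) = -wt ξ (piE (enum u v) L) := by
      have := lwt_eq_neg_wt ξ (enum u v) L
      unfold lwt at this
      simpa [rW] using this
    rw [e]
    field_simp
  -- strict θ-minimum on the lifted support
  have hmin : ∀ x ∈ Ch.GT.support, x ≠ x₀ → lwt θ x₀ < lwt θ x := by
    intro x hx hne
    obtain ⟨L, -, rfl⟩ := Ch.exists_of_mem_support_GT x hx
    obtain ⟨L₀', -, hL₀'⟩ := Ch.exists_of_mem_support_GT x₀ hx₀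
    have h1 := hmax _ hx hne
    rw [← hL₀', hlwL, hlwL, hL₀', hπ]
    have hcD : 0 < c / Ch.D := div_pos hcpos hDpos
    nlinarith
  have htor := toric_minLog Ch.M Ch.hM0 θ hθ (cU u v) (cV u v) x₀ ⟨hx₀, hmin⟩
  set R : ℕ := ⌊lwt θ x₀⌋₊ + 1 with hR
  have hRlt : lwt θ x₀ < (R : ℝ) := by rw [hR]; push_cast; exact Nat.lt_floor_add_one _
  obtain ⟨L₀, hL₀, hL₀x⟩ := Ch.exists_of_mem_support_GT x₀ hx₀
  have hκ₀ : L₀ ∈ Ch.Fib x₀ := (Ch.mem_Fib _ _).2 hL₀x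
  refine ⟨x₀, hπ, L₀, hL₀, hL₀x, ?_, ?_⟩
  · -- (a) nonvanishing at the free part of L₀
    have hne0 : x₀ ≠ 0 := fun h => Ch.zero_not_mem_support_GT (h ▸ hx₀)
    have hcls0 : lpP Lι L₀ ∈ Ch.cls Lι x₀ := Ch.lpP_mem_cls Lι hκ₀
    -- degree bookkeeping: 1 ≤ deg fr + B₀
    have h1 : 1 ≤ deg (frP Lι L₀) + Ch.bmin Lι x₀ := by
      by_contra hlt
      push Not at hlt
      have hfr0 : deg (frP Lι L₀) = 0 := by omega
      have hB0 : Ch.bmin Lι x₀ = 0 := by omega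
      obtain ⟨b, hb, hdb⟩ := Ch.exists_deg_eq_bmin Lι ⟨_, hcls0⟩
      rw [hB0] at hdb
      have hbz : b = 0 := by
        ext k; have := (deg_eq_sum b) ▸ hdb
        have : ∑ i, b i = 0 := by rw [← deg_eq_sum]; exact hdb
        exact (Finset.sum_eq_zero_iff.mp this) k (Finset.mem_univ k)
      have hall := Ch.cls_eq_zero_of_zero_mem Lι hc hpos hκ₀ (hbz ▸ hb)
      have hlp0 : lpP Lι L₀ = 0 := hall _ hcls0
      have hfrz : frP Lι L₀ = 0 := by
        ext k
        have : ∑ i, frP Lι L₀ i = 0 := by rw [← deg_eq_sum]; exact hfr0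
        exact (Finset.sum_eq_zero_iff.mp this) k (Finset.mem_univ k)
      apply hne0
      rw [← hL₀x, ← frP_add_lpP Lι L₀, hfrz, hlp0, add_zero]
      ext a; rw [piT_apply]; simp
    have hRfib : ∀ κ ∈ Ch.Fib x₀, deg κ ≤ R := by
      intro κ hκ
      have h2 : (deg κ : ℝ) ≤ lwt θ x₀ := (Nat.cast_le.mpr (Ch.deg_le_of_mem_Fib hκ)).trans (deg_le_lwt θ hθ x₀)
      exact_mod_cast (h2.trans_lt hRlt).le
    have hid := Ch.coeff_logTrunc_eq_Fsl Lι hc (cU u v) (cV u v) R (Ch.bmin Lι x₀) hκ₀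
      (fun b hb => Ch.bmin_le Lι hb) h1 hRfib
    have hcoef : coeff x₀ (phiT Ch.M (logTrunc (cU u v) (cV u v) R)) ≠ 0 := mem_support_iff.mp htor.1
    rw [hid] at hcoef
    unfold FslI ind
    rw [if_pos (frP_free Lι L₀), one_mul]
    intro hz
    apply hcoef
    rw [hz, mul_zero]
  · -- (b) competitors
    intro ν hne hνI
    have hνfree := free_of_FslI_ne_zero hνI
    have hνf : ∀ k ∈ Lι, freeOf ν k = 0 := fun k hk => by rw [coe_freeOf]; exact hνfree k hk
    set κ : Fin (sE u v) →₀ ℕ := freeOf ν + lpP Lι L₀ with hκdef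
    set x : Fin Ch.N →₀ ℕ := piT Ch.M κ with hxdef
    have hκx : κ ∈ Ch.Fib x := (Ch.mem_Fib _ _).2 rfl
    have hfrκ : frP Lι κ = freeOf ν := frP_add_of_free Lι hνf (lpP_pattern Lι L₀)
    have hxne : x ≠ x₀ := by
      intro h
      have hκ0 : κ ∈ Ch.Fib x₀ := (Ch.mem_Fib _ _).2 (by rw [← hxdef, h])
      have := Ch.frP_eq_of_mem_Fib Lι hc hκ₀ hκ0
      apply hne
      rw [← this, hfrκ, coe_freeOf]
    have hcls : Ch.cls Lι x = Ch.cls Lι x₀ := Ch.cls_free Lι hc hκ₀ hνfree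
    have hbm : Ch.bmin Lι x = Ch.bmin Lι x₀ := by unfold ChartData.bmin; rw [hcls]
    -- the weight difference is the free-part difference
    have hdiff : lwt θ x - lwt θ x₀ = c * (∑ k, rW (u := u) (v := v) ξ k * (ν k : ℝ) -
        ∑ k, rW (u := u) (v := v) ξ k * ((frP Lι L₀ k : ℕ) : ℝ)) := by
      rw [hxdef, ← hL₀x, hlw, hlw, ← mul_sub]
      congr 1
      conv_rhs => rw [← Finset.sum_sub_distrib]
      rw [← Finset.sum_sub_distrib]
      refine Finset.sum_congr rfl fun k _ => ?_
      have e1 : ((κ k : ℕ) : ℝ) = (ν k : ℝ) + ((lpP Lι L₀ k : ℕ) : ℝ) := by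
        rw [hκdef, Finsupp.add_apply, coe_freeOf]; push_cast; ring
      have e2 : ((L₀ k : ℕ) : ℝ) = ((frP Lι L₀ k : ℕ) : ℝ) + ((lpP Lι L₀ k : ℕ) : ℝ) := by
        conv_lhs => rw [← frP_add_lpP Lι L₀]
        rw [Finsupp.add_apply]; push_cast; ring
      rw [e1, e2]; ring
    -- it suffices to show lwt θ x₀ < lwt θ x
    suffices hlt : lwt θ x₀ < lwt θ x by
      have : 0 < lwt θ x - lwt θ x₀ := by linarith
      rw [hdiff] at this
      have := (mul_pos_iff_of_pos_left hcpos).mp this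
      linarith
    by_cases hbig : ∃ κ' ∈ Ch.Fib x, R < deg κ'
    · obtain ⟨κ', hκ', hRκ⟩ := hbig
      have h2 : (deg κ' : ℝ) ≤ lwt θ x := (Nat.cast_le.mpr (Ch.deg_le_of_mem_Fib hκ')).trans (deg_le_lwt θ hθ x)
      have h3 : (R : ℝ) < deg κ' := by exact_mod_cast hRκ
      linarith
    · push Not at hbig
      -- degenerate case: deg ν + B₀ = 0 is impossible
      have h1 : 1 ≤ deg (frP Lι κ) + Ch.bmin Lι x := by
        by_contra hlt
        push Not at hlt
        have hB0 : Ch.bmin Lι x₀ = 0 := by rw [← hbm]; omega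
        have hfr0 : deg (frP Lι κ) = 0 := by omega
        obtain ⟨b, hb, hdb⟩ := Ch.exists_deg_eq_bmin Lι ⟨_, Ch.lpP_mem_cls Lι hκ₀⟩
        rw [hB0] at hdb
        have hbz : b = 0 := by
          ext k
          have : ∑ i, b i = 0 := by rw [← deg_eq_sum]; exact hdb
          exact (Finset.sum_eq_zero_iff.mp this) k (Finset.mem_univ k)
        have hall := Ch.cls_eq_zero_of_zero_mem Lι hc hpos hκ₀ (hbz ▸ hb)
        have hν0 : ν = 0 := by
          funext k
          have : ∑ i, frP Lι κ i = 0 := by rw [← deg_eq_sum]; exact hfr0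
          have := (Finset.sum_eq_zero_iff.mp this) k (Finset.mem_univ k)
          rw [hfrκ, coe_freeOf] at this; exact this
        apply hνI
        unfold FslI
        rw [hν0, Fsl_trivial (cU u v) (cV u v) _ _ hall, mul_zero]
      have hid := Ch.coeff_logTrunc_eq_Fsl Lι hc (cU u v) (cV u v) R (Ch.bmin Lι x) hκx
        (fun b hb => Ch.bmin_le Lι hb) h1 hbig
      rw [hcls, hbm, hfrκ, coe_freeOf] at hid
      have hFsl : Fsl (Ch.cls Lι x₀) (Ch.bmin Lι x₀) (cU u v) (cV u v) ν ≠ 0 := by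
        intro hz; apply hνI; unfold FslI; rw [hz, mul_zero]
      have hpref : (-1 : ℂ) ^ (deg (freeOf ν) + 1) * (((deg (freeOf ν) + Ch.bmin Lι x₀ - 1).factorial : ℕ) : ℂ) /
          ((bfact (freeOf ν) : ℕ) : ℂ) ≠ 0 := by
        have hb : ((bfact (freeOf ν) : ℕ) : ℂ) ≠ 0 := by
          unfold bfact; exact Nat.cast_ne_zero.mpr (Finset.prod_ne_zero_iff.mpr fun i _ => Nat.factorial_ne_zero _)
        exact div_ne_zero (mul_ne_zero (pow_ne_zero _ (by norm_num)) (Nat.cast_ne_zero.mpr (Nat.factorial_ne_zero _))) hb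
      have hsupp : x ∈ (phiT Ch.M (logTrunc (cU u v) (cV u v) R)).support := by
        rw [mem_support_iff, hid]; exact mul_ne_zero hpref hFsl
      exact htor.2 x hsupp hxne

end SliceMin

end R10
end Summit.ValiantsHypothesis.ValiantsHypothesis.Theorems.NewtonUnitEquations.TwoProducts.PermutationType

end
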